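import Literature.Computability.Cryptography.PeriodFindingClassSums
import Literature.Computability.Cryptography.PeriodFindingDualAngles
import HarnessLib

/-!
# The window law of a jittered class sum: off-ball mass and near-uniformity of the read character

Topic `Computability/Cryptography` (harmonic analysis of period finding over `ℤ^T`); theorem-only file, no named facts.
Sequel of `PeriodFindingClassSums.lean` and `PeriodFindingDualAngles.lean`; the analytic core of the per-unit sampling law
of a shift-cell / coset table (class-group stage of the crux `LinnikCubicClassGroups.PureCubicClassGroupFBQP`).

Setting: a class table `cls` of a finite-index `Λ ≤ ℤ^T` (`h = [ℤ^T:Λ] ≤ hB`) on the register `[0, M^T)`, one class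
`A` (that of `E₀`), base angles `x`, unimodular weights `ψ(E)` with `|ψ(E) − 1| ≤ ερ` (the rounding jitter of the shifts
of the table), and the JITTERED CLASS SUM `Z(ν) = ∑_{E ∈ A} e(θ_ν·d(E)) ψ(E)`, `θ_ν t = x_t + ν/M^{T−t}`. A frequency `ν`
is ACCURATE for the dual vector `ζ ∈ ([0,1) ∩ ℚ)^T` (pairing integrally with `Λ`) when every angle `x_t + ζ_t + ν/M^{T−t}`
is within `2u/M` of an integer. With `α = hB²T/M`, `ε' = T/(u−2) + 2hB²(2u)^T/M`:

* `class_offBall_mass_le` — the mass `∑ |Z(ν)|²` of the frequencies accurate for NO dual vector is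
  `≤ (M^{2T}/h)(α + ε' + 2(1+α)ερ)` (out of the total `M^T #A ≈ M^{2T}/h`);
* `class_ball_mass_le` — for every dual vector `ζ₀`: `8h · (mass accurate for ζ₀) ≤ 9 · (mass accurate for some ζ)`,
  provided `8hB·α + 8hB·ε' + 16hB(1+α)ερ ≤ 1` — given the class, the read dual vector is `(1 + 1/8)`-near-uniform.

Proof: the windows (`u` grid steps) of the `h` characters are pairwise disjoint, each carries `≥ (M^{2T}/h²)(1−ε')` of the
unjittered energy (`class_window_energy_ge`), the jitter costs `≤ 2 M^T #A ερ` (`classSum_unperturbed_le`), the class has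
`#A ≤ (M^T/h)(1+α)` points (`cosetBoxCount`), the window of `χ` lies in the ball of its angle vector `ξ_χ`
(`exists_dualAngles`) and meets no other ball (separation `1/h > 3u/M`, `exists_inv_index_le_abs_sub_round`).

## References

* S. Hallgren, STOC 2005, §4. [Hallgren2005]
* A. Yu. Kitaev, arXiv:quant-ph/9511026 (1995), §4. [Kitaev1995]
-/

noncomputable section

namespace Literature.Computability.Cryptography

namespace PeriodFinding

open Complex Finset
open scoped Classical

variable {T : ℕ}

/-! ### Class sizes -/

/-- **Every class of a class table is small**: `#A ≤ (M^T/h)(1 + h²T/M)` (`h` classes whose sizes differ by at most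
`hTM^{T−1}`, `cosetBoxCount`). [folklore] -/
theorem card_class_le_real (hT : 0 < T) {M : ℕ} (hM : 0 < M) (Λ : AddSubgroup (Fin T → ℤ)) [Λ.FiniteIndex]
    (hMh : Λ.index ≤ M) (cls : ℕ → ℕ)
    (hcls : ∀ E < M ^ T, ∀ E' < M ^ T, cls E = cls E' ↔
      (fun t : Fin T => ((E / M ^ (t : ℕ) % M : ℕ) : ℤ) - ((E' / M ^ (t : ℕ) % M : ℕ) : ℤ)) ∈ Λ)
    {E₀ : ℕ} (hE₀ : E₀ < M ^ T) :
    ((((range (M ^ T)).filter (fun E => cls E = cls E₀)).card : ℕ) : ℝ) ≤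
      (M : ℝ) ^ T / Λ.index * (1 + (Λ.index : ℝ) ^ 2 * T / M) := by
  obtain ⟨hcount, hdiff⟩ := cosetBoxCount T M Λ hMh cls hcls
  set I := (range (M ^ T)).image cls with hI
  set N := ((range (M ^ T)).filter (fun E => cls E = cls E₀)).card with hN
  have hg : cls E₀ ∈ I := mem_image_of_mem cls (mem_range.2 hE₀)
  have hsum : ∑ g' ∈ I, ((range (M ^ T)).filter (fun E => cls E = g')).card = M ^ T := by
    have h := card_eq_sum_card_fiberwise (s := range (M ^ T)) (t := I) (f := cls) fun E hE => mem_image_of_mem cls hE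
    rw [card_range] at h
    exact h.symm
  have hnat : Λ.index * N ≤ M ^ T + Λ.index * (Λ.index * T * M ^ (T - 1)) := by
    calc Λ.index * N = ∑ g' ∈ I, N := by rw [sum_const, hcount, smul_eq_mul]
      _ ≤ ∑ g' ∈ I, (((range (M ^ T)).filter (fun E => cls E = g')).card + Λ.index * T * M ^ (T - 1)) :=
          sum_le_sum fun g' hg' => hdiff _ hg g' hg'
      _ = M ^ T + Λ.index * (Λ.index * T * M ^ (T - 1)) := by
          rw [sum_add_distrib, hsum, sum_const, hcount, smul_eq_mul]
  have hidx : 0 < Λ.index := Nat.pos_of_ne_zero AddSubgroup.FiniteIndex.index_ne_zero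
  have hhR : (0 : ℝ) < Λ.index := by exact_mod_cast hidx
  have hMR : (0 : ℝ) < M := by exact_mod_cast hM
  have hR : (Λ.index : ℝ) * N ≤ (M : ℝ) ^ T + Λ.index * (Λ.index * T * (M : ℝ) ^ (T - 1)) := by exact_mod_cast hnat
  have hpow : (M : ℝ) ^ (T - 1) = (M : ℝ) ^ T / M := by
    rw [eq_div_iff hMR.ne', ← pow_succ, Nat.sub_add_cancel hT]
  rw [hpow] at hR
  rw [show (M : ℝ) ^ T / Λ.index * (1 + (Λ.index : ℝ) ^ 2 * T / M) =
    ((M : ℝ) ^ T + Λ.index * (Λ.index * T * ((M : ℝ) ^ T / M))) / Λ.index by field_simp]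
  rw [le_div_iff₀ hhR]
  linarith

/-! ### The setting of the window law -/

section Side

variable {M : ℕ} (hM : 0 < M) (Λ : AddSubgroup (Fin T → ℤ)) [Λ.FiniteIndex] {hB : ℕ} (hhB : Λ.index ≤ hB)
  {u : ℕ} (hu : 3 ≤ u) (huM : (u : ℝ) / M ≤ 1 / (4 * hB))

include hM hu huM hhB in
/-- The numeric side conditions: `h ≤ M`, `u/M ≤ 1/(4h)`, `3u/M < 1/h`. [folklore] -/
theorem law_side_conditions :
    Λ.index ≤ M ∧ (u : ℝ) / M ≤ 1 / (4 * Λ.index) ∧ 3 * (u : ℝ) / M < 1 / Λ.index := by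
  have hidx : 0 < Λ.index := Nat.pos_of_ne_zero AddSubgroup.FiniteIndex.index_ne_zero
  have hhR : (0 : ℝ) < Λ.index := by exact_mod_cast hidx
  have hhBR : (Λ.index : ℝ) ≤ hB := by exact_mod_cast hhB
  have huR : (3 : ℝ) ≤ u := by exact_mod_cast hu
  have hMR : (0 : ℝ) < M := by exact_mod_cast hM
  have h1 : (u : ℝ) / M ≤ 1 / (4 * Λ.index) :=
    huM.trans (div_le_div_of_nonneg_left zero_le_one (by positivity) (by linarith))
  have h2 : (u : ℝ) * (4 * Λ.index) ≤ M := by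
    have := h1; rw [div_le_div_iff₀ hMR (by positivity), one_mul] at this; exact this
  refine ⟨?_, h1, ?_⟩
  · have : (Λ.index : ℝ) ≤ M := by nlinarith
    exact_mod_cast this
  · rw [div_lt_div_iff₀ hMR hhR]
    nlinarith

end Side

/-! ### Balls, windows and dual vectors -/

/-- **A ball and a window of two DISTINCT dual vectors do not meet**: if every angle `a_t + ζ_t` is within `2u/M` of `ℤ`
and every `a_t + ζ'_t` within `u/M`, for dual vectors `ζ, ζ'` of `[0,1)^T` and `3u/M < 1/h`, then `ζ = ζ'`. [folklore] -/
theorem dual_eq_of_ball_of_window {M u : ℕ} (Λ : AddSubgroup (Fin T → ℤ)) [Λ.FiniteIndex]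
    (h3u : 3 * (u : ℝ) / M < 1 / Λ.index) (ζ ζ' : Fin T → ℚ)
    (h01 : ∀ t, 0 ≤ ζ t ∧ ζ t < 1) (h01' : ∀ t, 0 ≤ ζ' t ∧ ζ' t < 1)
    (hζ : ∀ v ∈ Λ, ∃ z : ℤ, ∑ t, ζ t * (v t : ℚ) = z) (hζ' : ∀ v ∈ Λ, ∃ z : ℤ, ∑ t, ζ' t * (v t : ℚ) = z)
    (a : Fin T → ℝ) (hball : ∀ t : Fin T, |a t + ζ t - round (a t + ζ t)| ≤ 2 * (u : ℝ) / M)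
    (hwin : ∀ t : Fin T, |a t + ζ' t - round (a t + ζ' t)| < (u : ℝ) / M) : ζ = ζ' := by
  by_contra hne
  obtain ⟨t, ht⟩ := exists_inv_index_le_abs_sub_round Λ ζ ζ' h01 h01' hζ hζ' hne a
  have htri : |(a t + ζ t) - (a t + ζ' t) - round ((a t + ζ t) - (a t + ζ' t))| ≤
      |a t + ζ t - round (a t + ζ t)| + |a t + ζ' t - round (a t + ζ' t)| := by
    calc |(a t + ζ t) - (a t + ζ' t) - round ((a t + ζ t) - (a t + ζ' t))|
        ≤ |(a t + ζ t) - (a t + ζ' t) - ((round (a t + ζ t) - round (a t + ζ' t) : ℤ) : ℝ)| := round_le _ _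
      _ = |(a t + ζ t - round (a t + ζ t)) - (a t + ζ' t - round (a t + ζ' t))| := by push_cast; ring_nf
      _ ≤ _ := abs_sub _ _
  have e2 : 2 * (u : ℝ) / M = 2 * ((u : ℝ) / M) := by ring
  have e3 : 3 * (u : ℝ) / M = 3 * ((u : ℝ) / M) := by ring
  linarith [hball t, hwin t]

section Law

variable (hT : 0 < T) {M : ℕ} (hM : 0 < M) (Λ : AddSubgroup (Fin T → ℤ)) [Λ.FiniteIndex] {hB : ℕ} (hhB : Λ.index ≤ hB)
  (cls : ℕ → ℕ)
  (hcls : ∀ E < M ^ T, ∀ E' < M ^ T, cls E = cls E' ↔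
    (fun t : Fin T => ((E / M ^ (t : ℕ) % M : ℕ) : ℤ) - ((E' / M ^ (t : ℕ) % M : ℕ) : ℤ)) ∈ Λ)
  {E₀ : ℕ} (hE₀ : E₀ < M ^ T) (x : Fin T → ℝ) (ψ : ℕ → ℂ) {ερ : ℝ} (hερ : 0 ≤ ερ)
  (hψ : ∀ E < M ^ T, cls E = cls E₀ → ‖ψ E‖ = 1 ∧ ‖ψ E - 1‖ ≤ ερ)
  {u : ℕ} (hu : 3 ≤ u) (huM : (u : ℝ) / M ≤ 1 / (4 * hB))

include hM hψ in
/-- The total energy of the jittered class sum is `M^T #A`. [folklore] -/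
theorem classSum_total :
    ∑ ν ∈ range (M ^ T), ‖∑ E ∈ (range (M ^ T)).filter (fun E => cls E = cls E₀),
        eR (fun t => x t + (ν : ℝ) / (M : ℝ) ^ (T - (t : ℕ))) (toZ fun t : Fin T => E / M ^ (t : ℕ) % M) * ψ E‖ ^ 2 =
      (M : ℝ) ^ T * ((range (M ^ T)).filter (fun E => cls E = cls E₀)).card := by
  rw [sum_norm_sq_classSum hM x _ (filter_subset _ _) ψ]
  congr 1
  have h1 : ∀ E ∈ (range (M ^ T)).filter (fun E => cls E = cls E₀), ‖ψ E‖ ^ 2 = 1 := by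
    intro E hE
    obtain ⟨hEW, hcl⟩ := mem_filter.1 hE
    rw [(hψ E (mem_range.1 hEW) hcl).1, one_pow]
  rw [sum_congr rfl h1, sum_const, nsmul_eq_mul, mul_one]

include hT hM hhB hcls hE₀ hu huM in
/-- **Disjoint windows add up**: for a set `X` of characters, the unjittered energy of the union of their windows is at least
`#X · (M^{2T}/h²)(1 − T/(u−2) − 2h²(2u)^T/M)`. [cite: Hallgren2005, §4] -/
theorem classSum_windows_ge [Fintype ((Fin T → ℤ) ⧸ Λ)] [DecidableEq ((Fin T → ℤ) ⧸ Λ)]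
    (ξ : AddChar ((Fin T → ℤ) ⧸ Λ) ℂ → Fin T → ℚ) (hξ01 : ∀ χ t, 0 ≤ ξ χ t ∧ ξ χ t < 1)
    (hξchar : ∀ χ t, χ (QuotientAddGroup.mk (Pi.single t 1)) = cexp (2 * Real.pi * I * ((ξ χ t : ℝ) : ℂ)))
    (hξint : ∀ χ, ∀ v ∈ Λ, ∃ z : ℤ, ∑ t, ξ χ t * (v t : ℚ) = z) (hξinj : Function.Injective ξ)
    (X : Finset (AddChar ((Fin T → ℤ) ⧸ Λ) ℂ)) :
    (X.card : ℝ) * (((M : ℝ) ^ (2 * T) / (Λ.index : ℝ) ^ 2) *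
        (1 - (T : ℝ) / (u - 2) - 2 * (Λ.index : ℝ) ^ 2 * (2 * u) ^ T / M)) ≤
      ∑ ν ∈ (range (M ^ T)).filter (fun ν : ℕ => ∃ χ ∈ X, ∀ t : Fin T, (M : ℝ) *
          min (Int.fract (x t + (ξ χ t : ℝ) + (ν : ℝ) / (M : ℝ) ^ (T - (t : ℕ))))
            (1 - Int.fract (x t + (ξ χ t : ℝ) + (ν : ℝ) / (M : ℝ) ^ (T - (t : ℕ)))) < u),
        ‖∑ E ∈ (range (M ^ T)).filter (fun E => cls E = cls E₀),
            eR (fun t => x t + (ν : ℝ) / (M : ℝ) ^ (T - (t : ℕ))) (toZ fun t : Fin T => E / M ^ (t : ℕ) % M)‖ ^ 2 := by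
  obtain ⟨hMh, huM', h3u⟩ := law_side_conditions hM Λ hhB hu huM
  have hcard : Fintype.card ((Fin T → ℤ) ⧸ Λ) = Λ.index := by
    rw [AddSubgroup.index_eq_card, Nat.card_eq_fintype_card]
  -- the union of the windows of `X` is a disjoint union
  set Wd : AddChar ((Fin T → ℤ) ⧸ Λ) ℂ → Finset ℕ := fun χ => (range (M ^ T)).filter (fun ν : ℕ => ∀ t : Fin T, (M : ℝ) *
      min (Int.fract (x t + (ξ χ t : ℝ) + (ν : ℝ) / (M : ℝ) ^ (T - (t : ℕ))))
        (1 - Int.fract (x t + (ξ χ t : ℝ) + (ν : ℝ) / (M : ℝ) ^ (T - (t : ℕ)))) < u) with hWd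
  have hunion : (range (M ^ T)).filter (fun ν : ℕ => ∃ χ ∈ X, ∀ t : Fin T, (M : ℝ) *
      min (Int.fract (x t + (ξ χ t : ℝ) + (ν : ℝ) / (M : ℝ) ^ (T - (t : ℕ))))
        (1 - Int.fract (x t + (ξ χ t : ℝ) + (ν : ℝ) / (M : ℝ) ^ (T - (t : ℕ)))) < u) = X.biUnion Wd := by
    ext ν
    simp only [mem_filter, mem_biUnion, hWd]
    constructor
    · rintro ⟨hν, χ, hχ, hw⟩; exact ⟨χ, hχ, hν, hw⟩
    · rintro ⟨χ, hχ, hν, hw⟩; exact ⟨hν, χ, hχ, hw⟩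
  have hdisj : Set.PairwiseDisjoint (↑X) Wd := by
    intro χ _ χ' _ hne
    refine disjoint_left.2 fun ν hν hν' => hne ?_
    simp only [hWd, mem_filter] at hν hν'
    -- both windows put every angle within `u/M` of `ℤ`; separation forces `ξ χ = ξ χ'`
    have hb : ∀ t : Fin T, |(x t + (ν : ℝ) / (M : ℝ) ^ (T - (t : ℕ))) + (ξ χ t : ℝ) -
        round ((x t + (ν : ℝ) / (M : ℝ) ^ (T - (t : ℕ))) + (ξ χ t : ℝ))| ≤ 2 * (u : ℝ) / M := by
      intro t
      have := abs_sub_round_lt_of_window hM (hν.2 t)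
      rw [show x t + (ξ χ t : ℝ) + (ν : ℝ) / (M : ℝ) ^ (T - (t : ℕ)) =
        (x t + (ν : ℝ) / (M : ℝ) ^ (T - (t : ℕ))) + (ξ χ t : ℝ) by ring] at this
      have h2 : (u : ℝ) / M ≤ 2 * (u : ℝ) / M := by
        rw [mul_div_assoc]; linarith [show (0 : ℝ) ≤ (u : ℝ) / M by positivity]
      exact le_of_lt (this.trans_le h2)
    have hw : ∀ t : Fin T, |(x t + (ν : ℝ) / (M : ℝ) ^ (T - (t : ℕ))) + (ξ χ' t : ℝ) -
        round ((x t + (ν : ℝ) / (M : ℝ) ^ (T - (t : ℕ))) + (ξ χ' t : ℝ))| < (u : ℝ) / M := by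
      intro t
      have := abs_sub_round_lt_of_window hM (hν'.2 t)
      rwa [show x t + (ξ χ' t : ℝ) + (ν : ℝ) / (M : ℝ) ^ (T - (t : ℕ)) =
        (x t + (ν : ℝ) / (M : ℝ) ^ (T - (t : ℕ))) + (ξ χ' t : ℝ) by ring] at this
    exact hξinj (dual_eq_of_ball_of_window Λ h3u (ξ χ) (ξ χ') (hξ01 χ) (hξ01 χ') (hξint χ) (hξint χ') _ hb hw)
  rw [hunion, sum_biUnion hdisj]
  have hwin : ∀ χ ∈ X, ((M : ℝ) ^ (2 * T) / (Λ.index : ℝ) ^ 2) *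
      (1 - (T : ℝ) / (u - 2) - 2 * (Λ.index : ℝ) ^ 2 * (2 * u) ^ T / M) ≤
      ∑ ν ∈ Wd χ, ‖∑ E ∈ (range (M ^ T)).filter (fun E => cls E = cls E₀),
        eR (fun t => x t + (ν : ℝ) / (M : ℝ) ^ (T - (t : ℕ))) (toZ fun t : Fin T => E / M ^ (t : ℕ) % M)‖ ^ 2 := by
    intro χ _
    have h := class_window_energy_ge hT M hM Λ cls hcls hE₀ x χ (fun t => (ξ χ t : ℝ)) (hξchar χ) hu
      (by rw [hcard]; exact huM')
    rw [hcard] at h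
    exact h
  calc (X.card : ℝ) * (((M : ℝ) ^ (2 * T) / (Λ.index : ℝ) ^ 2) *
        (1 - (T : ℝ) / (u - 2) - 2 * (Λ.index : ℝ) ^ 2 * (2 * u) ^ T / M))
      = ∑ χ ∈ X, ((M : ℝ) ^ (2 * T) / (Λ.index : ℝ) ^ 2) *
        (1 - (T : ℝ) / (u - 2) - 2 * (Λ.index : ℝ) ^ 2 * (2 * u) ^ T / M) := by rw [sum_const, nsmul_eq_mul]
    _ ≤ _ := sum_le_sum hwin

end Law

/-- **Off-ball mass of a jittered class sum.** The energy of the frequencies `ν < M^T` that are accurate (every angle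
`x_t + ζ_t + ν/M^{T−t}` within `2u/M` of `ℤ`) for NO dual vector `ζ ∈ ([0,1) ∩ ℚ)^T` of `Λ` is at most
`(M^{2T}/h)·(α + ε' + 2(1+α)ερ)`, `α = hB²T/M`, `ε' = T/(u−2) + 2hB²(2u)^T/M`. [cite: Hallgren2005, §4] -/
theorem class_offBall_mass_le : ∀ {T : ℕ}, 0 < T → ∀ {M : ℕ}, 0 < M → ∀ (Λ : AddSubgroup (Fin T → ℤ)) [Λ.FiniteIndex]
    {hB : ℕ}, Λ.index ≤ hB → ∀ (cls : ℕ → ℕ), (∀ E < M ^ T, ∀ E' < M ^ T, cls E = cls E' ↔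
      (fun t : Fin T => ((E / M ^ (t : ℕ) % M : ℕ) : ℤ) - ((E' / M ^ (t : ℕ) % M : ℕ) : ℤ)) ∈ Λ) →
    ∀ {E₀ : ℕ}, E₀ < M ^ T → ∀ (x : Fin T → ℝ) (ψ : ℕ → ℂ) {ερ : ℝ}, 0 ≤ ερ →
    (∀ E < M ^ T, cls E = cls E₀ → ‖ψ E‖ = 1 ∧ ‖ψ E - 1‖ ≤ ερ) →
    ∀ {u : ℕ}, 3 ≤ u → (u : ℝ) / M ≤ 1 / (4 * hB) →
    ∑ ν ∈ (Finset.range (M ^ T)).filter (fun ν : ℕ => ¬ ∃ ζ : Fin T → ℚ, ((∀ t, 0 ≤ ζ t ∧ ζ t < 1) ∧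
        ∀ v ∈ Λ, ∃ z : ℤ, ∑ t, ζ t * (v t : ℚ) = z) ∧
        ∀ t : Fin T, |x t + (ζ t : ℝ) + (ν : ℝ) / (M : ℝ) ^ (T - (t : ℕ)) -
          round (x t + (ζ t : ℝ) + (ν : ℝ) / (M : ℝ) ^ (T - (t : ℕ)))| ≤ 2 * (u : ℝ) / M),
      ‖∑ E ∈ (Finset.range (M ^ T)).filter (fun E => cls E = cls E₀),
        eR (fun t => x t + (ν : ℝ) / (M : ℝ) ^ (T - (t : ℕ))) (toZ fun t : Fin T => E / M ^ (t : ℕ) % M) * ψ E‖ ^ 2 ≤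
      ((M : ℝ) ^ (2 * T) / Λ.index) * ((hB : ℝ) ^ 2 * T / M + ((T : ℝ) / (u - 2) + 2 * (hB : ℝ) ^ 2 * (2 * u) ^ T / M) +
        2 * (1 + (hB : ℝ) ^ 2 * T / M) * ερ) := by
  intro T hT M hM Λ _ hB hhB cls hcls E₀ hE₀ x ψ ερ hερ hψ u hu huM
  letI := Λ.fintypeQuotientOfFiniteIndex
  obtain ⟨hMh, huM', h3u⟩ := law_side_conditions hM Λ hhB hu huM
  have hcard : Fintype.card ((Fin T → ℤ) ⧸ Λ) = Λ.index := by
    rw [AddSubgroup.index_eq_card, Nat.card_eq_fintype_card]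
  have hidx : 0 < Λ.index := Nat.pos_of_ne_zero AddSubgroup.FiniteIndex.index_ne_zero
  have hhR : (0 : ℝ) < Λ.index := by exact_mod_cast hidx
  have hhBR : (Λ.index : ℝ) ≤ hB := by exact_mod_cast hhB
  have hMR : (0 : ℝ) < M := by exact_mod_cast hM
  obtain ⟨ξ, hξ01, hξchar, hξint, hξinj⟩ := exists_dualAngles Λ
  -- abbreviations
  set W : ℕ := M ^ T with hW
  set A := (range W).filter (fun E => cls E = cls E₀) with hA
  set Z : ℕ → ℂ := fun ν => ∑ E ∈ A,
    eR (fun t => x t + (ν : ℝ) / (M : ℝ) ^ (T - (t : ℕ))) (toZ fun t : Fin T => E / M ^ (t : ℕ) % M) * ψ E with hZ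
  set Z0 : ℕ → ℂ := fun ν => ∑ E ∈ A,
    eR (fun t => x t + (ν : ℝ) / (M : ℝ) ^ (T - (t : ℕ))) (toZ fun t : Fin T => E / M ^ (t : ℕ) % M) with hZ0
  set AccP : ℕ → Prop := fun ν : ℕ => ∃ ζ : Fin T → ℚ, ((∀ t, 0 ≤ ζ t ∧ ζ t < 1) ∧
        ∀ v ∈ Λ, ∃ z : ℤ, ∑ t, ζ t * (v t : ℚ) = z) ∧
        ∀ t : Fin T, |x t + (ζ t : ℝ) + (ν : ℝ) / (M : ℝ) ^ (T - (t : ℕ)) -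
          round (x t + (ζ t : ℝ) + (ν : ℝ) / (M : ℝ) ^ (T - (t : ℕ)))| ≤ 2 * (u : ℝ) / M with hAccP
  set WinP : ℕ → Prop := fun ν : ℕ => ∃ χ ∈ (univ : Finset (AddChar ((Fin T → ℤ) ⧸ Λ) ℂ)), ∀ t : Fin T, (M : ℝ) *
      min (Int.fract (x t + (ξ χ t : ℝ) + (ν : ℝ) / (M : ℝ) ^ (T - (t : ℕ))))
        (1 - Int.fract (x t + (ξ χ t : ℝ) + (ν : ℝ) / (M : ℝ) ^ (T - (t : ℕ)))) < u with hWinP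
  -- windows are accurate
  have hWinAcc : ∀ ν, WinP ν → AccP ν := by
    rintro ν ⟨χ, -, hw⟩
    refine ⟨ξ χ, ⟨hξ01 χ, hξint χ⟩, fun t => ?_⟩
    have h1 := abs_sub_round_lt_of_window hM (hw t)
    have h2 : (u : ℝ) / M ≤ 2 * (u : ℝ) / M := by
      rw [mul_div_assoc]; linarith [show (0 : ℝ) ≤ (u : ℝ) / M by positivity]
    exact le_of_lt (h1.trans_le h2)
  -- energies
  have htot : ∑ ν ∈ range W, ‖Z ν‖ ^ 2 = (W : ℝ) * A.card := by
    have := classSum_total hM cls x ψ hψ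
    simpa only [hW, Nat.cast_pow] using this
  have hN : (A.card : ℝ) ≤ (M : ℝ) ^ T / Λ.index * (1 + (Λ.index : ℝ) ^ 2 * T / M) :=
    card_class_le_real hT hM Λ hMh cls hcls hE₀
  have hwin : ((univ : Finset (AddChar ((Fin T → ℤ) ⧸ Λ) ℂ)).card : ℝ) *
      (((M : ℝ) ^ (2 * T) / (Λ.index : ℝ) ^ 2) * (1 - (T : ℝ) / (u - 2) - 2 * (Λ.index : ℝ) ^ 2 * (2 * u) ^ T / M)) ≤
      ∑ ν ∈ (range W).filter (fun ν => WinP ν), ‖Z0 ν‖ ^ 2 :=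
    classSum_windows_ge hT hM Λ hhB cls hcls hE₀ x hu huM ξ hξ01 hξchar hξint hξinj univ
  have huniv : ((univ : Finset (AddChar ((Fin T → ℤ) ⧸ Λ) ℂ)).card : ℝ) = Λ.index := by
    rw [card_univ, AddChar.card_eq, hcard]
  rw [huniv] at hwin
  have hpert : ∑ ν ∈ (range W).filter (fun ν => WinP ν), ‖Z0 ν‖ ^ 2 ≤
      ∑ ν ∈ (range W).filter (fun ν => WinP ν), ‖Z ν‖ ^ 2 + 2 * (M : ℝ) ^ T * A.card * ερ :=
    classSum_unperturbed_le hM x A (filter_subset _ _) ψ hερ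
      (fun E hE => (hψ E (mem_range.1 (mem_filter.1 hE).1) (mem_filter.1 hE).2).2) _ (filter_subset _ _)
  -- the off-ball set lies off all windows
  have hsub : ∑ ν ∈ (range W).filter (fun ν => ¬ AccP ν), ‖Z ν‖ ^ 2 ≤
      ∑ ν ∈ (range W).filter (fun ν => ¬ WinP ν), ‖Z ν‖ ^ 2 :=
    sum_le_sum_of_subset_of_nonneg (fun ν hν => mem_filter.2 ⟨(mem_filter.1 hν).1,
      fun hw => (mem_filter.1 hν).2 (hWinAcc ν hw)⟩) fun _ _ _ => by positivity
  have hsplit : ∑ ν ∈ (range W).filter (fun ν => WinP ν), ‖Z ν‖ ^ 2 +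
      ∑ ν ∈ (range W).filter (fun ν => ¬ WinP ν), ‖Z ν‖ ^ 2 = (W : ℝ) * A.card := by
    rw [sum_filter_add_sum_filter_not, htot]
  -- assemble
  have hWR : (W : ℝ) = (M : ℝ) ^ T := by rw [hW, Nat.cast_pow]
  have hM2T : (M : ℝ) ^ (2 * T) = (M : ℝ) ^ T * (M : ℝ) ^ T := by rw [two_mul, pow_add]
  have hWN : (W : ℝ) * A.card ≤ (M : ℝ) ^ (2 * T) / Λ.index * (1 + (hB : ℝ) ^ 2 * T / M) := by
    rw [hWR, hM2T]
    calc (M : ℝ) ^ T * A.card ≤ (M : ℝ) ^ T * ((M : ℝ) ^ T / Λ.index * (1 + (Λ.index : ℝ) ^ 2 * T / M)) := by gcongr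
      _ ≤ (M : ℝ) ^ T * ((M : ℝ) ^ T / Λ.index * (1 + (hB : ℝ) ^ 2 * T / M)) := by gcongr
      _ = _ := by ring
  have hεmono : (T : ℝ) / (u - 2) + 2 * (Λ.index : ℝ) ^ 2 * (2 * u) ^ T / M ≤
      (T : ℝ) / (u - 2) + 2 * (hB : ℝ) ^ 2 * (2 * u) ^ T / M := by gcongr
  have hB2 : (M : ℝ) ^ (2 * T) / (Λ.index : ℝ) ^ 2 * Λ.index = (M : ℝ) ^ (2 * T) / Λ.index := by
    field_simp
  -- `off ≤ W N (1 + 2 ερ) − h B (1 − ε')`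
  have key : ∑ ν ∈ (range W).filter (fun ν => ¬ WinP ν), ‖Z ν‖ ^ 2 ≤
      (W : ℝ) * A.card + 2 * (M : ℝ) ^ T * A.card * ερ -
        (Λ.index : ℝ) * (((M : ℝ) ^ (2 * T) / (Λ.index : ℝ) ^ 2) *
          (1 - (T : ℝ) / (u - 2) - 2 * (Λ.index : ℝ) ^ 2 * (2 * u) ^ T / M)) := by linarith
  refine hsub.trans (key.trans ?_)
  rw [hWR] at hWN ⊢
  have hpos : (0 : ℝ) ≤ (M : ℝ) ^ (2 * T) / Λ.index := by positivity
  have e1 : (Λ.index : ℝ) * (((M : ℝ) ^ (2 * T) / (Λ.index : ℝ) ^ 2) *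
      (1 - (T : ℝ) / (u - 2) - 2 * (Λ.index : ℝ) ^ 2 * (2 * u) ^ T / M)) =
      (M : ℝ) ^ (2 * T) / Λ.index * (1 - ((T : ℝ) / (u - 2) + 2 * (Λ.index : ℝ) ^ 2 * (2 * u) ^ T / M)) := by
    field_simp
    ring
  rw [e1]
  have e2 : 2 * (M : ℝ) ^ T * A.card * ερ = ((M : ℝ) ^ T * A.card) * (2 * ερ) := by ring
  rw [e2]
  have h3 : ((M : ℝ) ^ T * A.card) * (2 * ερ) ≤ ((M : ℝ) ^ (2 * T) / Λ.index * (1 + (hB : ℝ) ^ 2 * T / M)) * (2 * ερ) :=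
    mul_le_mul_of_nonneg_right hWN (by positivity)
  have h4 : (M : ℝ) ^ (2 * T) / Λ.index * (1 - ((T : ℝ) / (u - 2) + 2 * (hB : ℝ) ^ 2 * (2 * u) ^ T / M)) ≤
      (M : ℝ) ^ (2 * T) / Λ.index * (1 - ((T : ℝ) / (u - 2) + 2 * (Λ.index : ℝ) ^ 2 * (2 * u) ^ T / M)) :=
    mul_le_mul_of_nonneg_left (by linarith) hpos
  nlinarith [h3, h4, hWN, hpos]

end PeriodFinding

end Literature.Computability.Cryptography
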